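import Summits.KontsevichZagierPeriods.KontsevichZagierPeriods.Theorems.TerasomaMultiplicationBetaCancellationWeightDescent
import Summits.KontsevichZagierPeriods.KontsevichZagierPeriods.Theorems.LiouvilleUnfoldingAyoubPiCancellationStubStripWeight
import Summits.KontsevichZagierPeriods.KontsevichZagierPeriods.Theorems.LiouvilleUnfoldingAyoubPiCancellationStubStripConst
import Summits.KontsevichZagierPeriods.KontsevichZagierPeriods.Theorems.LiouvilleUnfoldingAyoubPiCancellationStubBandLift

/-!
# Crux stmt-KontsevichZagierPeriods-0540 (`LiouvilleUnfolding.AyoubPiCancellation` ≡ `KZ.PiCancellation`),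
# line `Sketch` (idea `moving-segment-wronskian`): stub `stub_bandFinishing` (A2)

Support file (`--supports` stmt-KontsevichZagierPeriods-0540) of the line skeleton, registered stub
`stub_bandFinishing` (M, glue) — **(A2), the finishing half of the Wronskian**: a `z₀`-FIBRED
certificate for the interior BAND family forces `c ∈ relations`.

Fix an interior strip `-1 < a < b < 1` (`a b` rational) and the pinned BAND family
`B n r = [{z : ℝⁿ⁺² | z 0² + z 1² ≤ 1, a < z 0 < b, tail z ∈ σ_r}, g_r ∘ tail]`. If the band
certificate `lift (of ∘ B) c` of a formal combination `c` is a `z₀`-fibred relation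
(`KZ.fibredRelations`: additivity, substitutions fixing `z 0`, Newton–Leibniz over bases of
dimension `≥ 1`), then `c ∈ relations`.

Proof (`bandFinishing_of_weight`, for any admissible weight `w` vanishing off `(a, b)` whose
weighted disc finishes; the stub is the strip weight `w_{a,b}(t) = 𝟙_{(a,b)}(t) / (2√(1 − t²))`).
Let `M = M_w` be the multiplier of `w` (`BetaCancellationLine.stub_weightExists`,
`BetaCancellationLine.exists_weightMul`).
(1) A fibred substitution fixes `z 0`, hence preserves `w (z 0)`, so `fibredRelations` lies in the
closure of the `w`-preserving generators and `M (lift (of ∘ B) c) ∈ relations`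
(`BetaCancellationLine.stub_weightMul`). (2) On the band family `M` computes `[Bw] * c` with
`Bw = [band, w (z 0)]` the slab restriction of the weighted disc `Dw = [D, w (z 0)]` to
`{a < z 0 < b}` (`stub_bandLift`), so `[Bw] * c ∈ relations`. (3) `[Dw] − [Bw] ∈ relations`: cutting
`Dw` at `z 0 = a, b` is a domain-additivity move (`KZ.IntegralRep.of_sub_of_slabRestrict_sub_of_slabCompl_mem`)
and the complementary piece has integrand `w (z 0) = 0` off the slab
(`KZ.of_mem_relations_of_eqOn_zero`). (4) Hence `[Dw] * c ∈ relations` (`relations` is a right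
ideal, `KZ.mul_mem_relations_right_holds`), and the weighted disc finishes. For the strip weight:
admissible by `stub_stripWeight`, and `[D, w_{a,b}] ∼ b − a ≠ 0` against every factor by
`stub_stripConst`, which finishes by
`BetaCancellationLine.mem_relations_of_of_mul_mem_of_forall_prod_equivalent`.
No definitions; sorry-free; axioms ⊆ {propext, Classical.choice, Quot.sound}.

References: M. Kontsevich, D. Zagier, *Periods* (2001), §1.2 (rules (1)–(3)), §4.1; J. Ayoub,
*Une version relative de la conjecture des périodes de Kontsevich–Zagier*, Ann. of Math. 181
(2015), §1.
-/

noncomputable section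

-- `Summit.KontsevichZagierPeriods.KontsevichZagierPeriods.…` is the tree's mandated layout (single-conjunct summit).
set_option linter.dupNamespace false

namespace Summit.KontsevichZagierPeriods.KontsevichZagierPeriods.AyoubPiCancellationLine

open Set MeasureTheory
open Literature.NumberTheory.Transcendental
open Literature.NumberTheory.Transcendental.KZ
open Summit.KontsevichZagierPeriods.KontsevichZagierPeriods.BetaCancellationLine
  (stub_weightExists exists_weightMul stub_weightMul
    mem_relations_of_of_mul_mem_of_forall_prod_equivalent)

-- adapted from Summits/KontsevichZagierPeriods/KontsevichZagierPeriods/Theorems/TerasomaMultiplicationBetaCancellationWeightDescent.lean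
-- (`weightDescent` with the disc family replaced by the band family and `stub_weightLift` by
-- `stub_bandLift`; closure bookkeeping of `piMul_mem_weightClosure`)

/-! ### Fibred relations are `w`-preserving relations, for every weight `w` -/

/-- **A fibred relation is a `w`-preserving relation for EVERY weight `w` of the first
coordinate**: a fibred change of variables fixes `x 0` (`Φ x 0 = x 0`), hence trivially preserves
`w (x 0)`; the other three kinds of fibred generators are `w`-preserving generators verbatim.
[folklore] -/
theorem fibredRelations_le_weightClosure (w : ℝ → ℝ) :
    fibredRelations ≤
      AddSubgroup.closure (domainAddRel ∪ integrandAddRel ∪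
          {x | ∃ (n : ℕ) (r r' : IntegralRep (n + 1)) (Φ : (Fin (n + 1) → ℝ) → (Fin (n + 1) → ℝ))
              (Φ' : (Fin (n + 1) → ℝ) → (Fin (n + 1) → ℝ) →L[ℝ] (Fin (n + 1) → ℝ)),
            IsSemialgebraicMapOn ℚ r.domain Φ ∧
            (∀ x ∈ r.domain, HasFDerivWithinAt Φ (Φ' x) r.domain x) ∧ Set.InjOn Φ r.domain ∧
            r'.domain = Φ '' r.domain ∧
            (∀ x ∈ r.domain, r.integrand x = r'.integrand (Φ x) * |(Φ' x).det|) ∧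
            (∀ x ∈ r.domain, w (Φ x 0) = w (x 0)) ∧
            x = of r - of r'} ∪
          fibredNewtonLeibnizRel) := by
  rw [fibredRelations_def]
  refine AddSubgroup.closure_mono ?_
  rw [fibredGenerators_def]
  rintro y (((hy | hy) | hy) | hy)
  · exact Or.inl (Or.inl (Or.inl hy))
  · exact Or.inl (Or.inl (Or.inr hy))
  · obtain ⟨k, r, r', Φ, Φ', hΦ, hΦ', hinj, hdom, hf, h0, rfl⟩ := hy
    exact Or.inl (Or.inr ⟨k, r, r', Φ, Φ', hΦ, hΦ', hinj, hdom, hf,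
      fun x hx => by rw [h0 x hx], rfl⟩)
  · exact Or.inr hy

/-! ### Band finishing for an arbitrary finishing weight supported in the strip -/

/-- **Band finishing, general weight.** Let `w` be a bounded weight of one real variable,
`ℚ`-semialgebraic on `ℝ¹` through `x 0`, VANISHING OFF `(a, b)`, with weighted disc
`Dw = [D, w (z 0)]` that finishes (`[Dw] * c ∈ relations → c ∈ relations`). Then every `c` whose
band certificate `lift (of ∘ B) c` over the strip `(a, b)` is a fibred relation is itself a
relation: the multiplier `M_w` kills the fibred certificate (`stub_weightMul`,
`fibredRelations_le_weightClosure`) and computes `[Bw] * c` on it (`stub_bandLift`, `Bw` the slab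
restriction of `Dw`), while `[Dw] ≡ [Bw]` because `w` vanishes on the complementary piece.
[folklore] -/
theorem bandFinishing_of_weight (a b : ℚ) (w : ℝ → ℝ)
    (hw : IsSemialgebraicFunOn ℚ (Set.univ : Set (Fin 1 → ℝ)) (fun x => w (x 0)))
    (C : ℝ) (hC : ∀ t : ℝ, |w t| ≤ C)
    (hoff : ∀ t : ℝ, t ∉ Set.Ioo (a : ℝ) b → w t = 0)
    {Dw : IntegralRep 2} (hDw : Dw.domain = piDisc) (hDw1 : Dw.integrand = fun z => w (z 0))
    (hfin : ∀ c : FormalRep, of Dw * c ∈ relations → c ∈ relations)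
    (B : ∀ n : ℕ, IntegralRep n → IntegralRep (n + 2))
    (hB : ∀ (n : ℕ) (r : IntegralRep n),
      (B n r).domain = {z : Fin (n + 2) → ℝ | z 0 ^ 2 + z 1 ^ 2 ≤ 1 ∧ ((a : ℝ) < z 0 ∧ z 0 < b) ∧
        (fun i : Fin n => z i.succ.succ) ∈ r.domain} ∧
      (B n r).integrand = fun z => r.integrand (fun i : Fin n => z i.succ.succ))
    (c : FormalRep)
    (hc : FreeAbelianGroup.lift (fun s : (Σ n, IntegralRep n) => of (B s.1 s.2)) c ∈ fibredRelations) :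
    c ∈ relations := by
  -- the multiplier of `w`
  have hex := stub_weightExists w hw C hC
  obtain ⟨M, h0, hpin⟩ := exists_weightMul w hex
  -- (1) `M` kills the fibred certificate
  have h1 : M (FreeAbelianGroup.lift (fun s : (Σ n, IntegralRep n) => of (B s.1 s.2)) c) ∈
      relations :=
    stub_weightMul w hw hex M h0 hpin _ (fibredRelations_le_weightClosure w hc)
  -- (2) on the band family `M` computes `[Bw] * c`, `Bw` the slab restriction of `Dw`
  have hBw : (Dw.slabRestrict a b).domain =
      {z : Fin 2 → ℝ | z 0 ^ 2 + z 1 ^ 2 ≤ 1 ∧ ((a : ℝ) < z 0 ∧ z 0 < b)} := by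
    rw [IntegralRep.domain_slabRestrict, hDw]
    ext z
    -- `z : Fin (1 + 1) → ℝ` here, so unfold `piDisc` rather than use `mem_piDisc` (keyed on `Fin 2`)
    simp only [mem_inter_iff, piDisc, mem_paramSlab, mem_setOf_eq]
  have hBw1 : (Dw.slabRestrict a b).integrand = fun z => w (z 0) := by
    rw [IntegralRep.integrand_slabRestrict, hDw1]
  have h2 := stub_bandLift a b w hex B hB (Dw.slabRestrict a b) hBw hBw1 M hpin c
  have h3 : of (Dw.slabRestrict a b) * c ∈ relations := by
    simpa using relations.add_mem h2 h1
  -- (3) `[Dw] − [Bw] ∈ relations`: cut at `z 0 = a, b`; the complementary piece has zero integrand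
  have hcut : of Dw - of (Dw.slabRestrict a b) - of (Dw.slabCompl a b) ∈ relations :=
    domainAddRel_subset_relations (IntegralRep.of_sub_of_slabRestrict_sub_of_slabCompl_mem Dw a b)
  have hcompl : of (Dw.slabCompl a b) ∈ relations := by
    refine of_mem_relations_of_eqOn_zero _ (fun z hz => ?_)
    rw [IntegralRep.domain_slabCompl] at hz
    rw [IntegralRep.integrand_slabCompl, hDw1, Pi.zero_apply]
    exact hoff (z 0) (fun h => hz.2 (mem_paramSlab.2 h))
  -- (4) `[Dw] * c ∈ relations` (`relations` is a right ideal)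
  have h4 : of Dw * c ∈ relations := by
    have e : of Dw * c =
        (of Dw - of (Dw.slabRestrict a b) - of (Dw.slabCompl a b)) * c +
          of (Dw.slabCompl a b) * c + of (Dw.slabRestrict a b) * c := by
      simp only [sub_mul]; abel
    rw [e]
    exact relations.add_mem (relations.add_mem (mul_mem_relations_right_holds _ _ hcut)
      (mul_mem_relations_right_holds _ _ hcompl)) h3
  -- (5) the weighted disc finishes
  exact hfin c h4

/-! ### The stub -/

/-- **STUB `stub_bandFinishing`** (M, glue) of the line `Sketch` — **(A2), the finishing half of
the Wronskian**: a `z₀`-FIBRED certificate for the interior band family `[D ∩ {a < z₀ < b}] ⊗ c`,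
`-1 < a < b < 1`, forces `c ∈ relations`. The multiplier `M` of the strip weight
`w_{a,b}(z₀) = 𝟙_{(a,b)}(z₀) / (2√(1 − z₀²))` (admissible by `stub_stripWeight`;
`BetaCancellationLine.stub_weightExists`, `exists_weightMul`) maps `fibredRelations` into
`relations` (`stub_weightMul`; a fibred substitution preserves `z₀`, hence the weight), computes
`[band, w_{a,b}] * c` on the band family (`stub_bandLift`), and `[band, w_{a,b}] ∼ [D, w_{a,b}]`
(the weight vanishes off the band) `∼ b − a ≠ 0` against every factor (`stub_stripConst`), so
`BetaCancellationLine.mem_relations_of_of_mul_mem_of_forall_prod_equivalent` finishes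
(`bandFinishing_of_weight`). [folklore] -/
theorem stub_bandFinishing : ∀ (a b : ℚ), -1 < a → a < b → b < 1 →
    ∀ (B : ∀ n : ℕ, IntegralRep n → IntegralRep (n + 2)),
      (∀ (n : ℕ) (r : IntegralRep n),
        (B n r).domain = {z : Fin (n + 2) → ℝ | z 0 ^ 2 + z 1 ^ 2 ≤ 1 ∧ ((a : ℝ) < z 0 ∧ z 0 < b) ∧
          (fun i : Fin n => z i.succ.succ) ∈ r.domain} ∧
        (B n r).integrand = fun z => r.integrand (fun i : Fin n => z i.succ.succ)) →
      ∀ c : FormalRep,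
        FreeAbelianGroup.lift (fun s : (Σ n, IntegralRep n) => of (B s.1 s.2)) c ∈ fibredRelations →
          c ∈ relations := by
  intro a b ha hab hb B hB c hc
  -- the admissible weight (semialgebraic on `ℝ¹`, bounded), vanishing off `(a, b)`
  obtain ⟨hw, C, hC⟩ := stub_stripWeight a b ha hab hb
  -- the finishing weighted disc `[D, w_{a,b}] ∼ b - a`
  obtain ⟨Dw, hDw, hDw1, hDwc⟩ := stub_stripConst a b ha hab hb
  have hκ : IsAlgebraic ℚ ((b - a : ℚ) : ℝ) := by
    have h := isAlgebraic_algebraMap (R := ℚ) (A := ℝ) (b - a : ℚ)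
    rwa [eq_ratCast] at h
  have hκ0 : ((b - a : ℚ) : ℝ) ≠ 0 := by exact_mod_cast (sub_pos.2 hab).ne'
  exact bandFinishing_of_weight a b
    ((Set.Ioo (a : ℝ) b).indicator (fun t => 1 / (2 * Real.sqrt (1 - t ^ 2)))) hw C hC
    (fun t ht => indicator_of_notMem ht _) hDw hDw1
    (fun c hc => mem_relations_of_of_mul_mem_of_forall_prod_equivalent Dw hκ hκ0 (hDwc hκ) c hc)
    B hB c hc

end Summit.KontsevichZagierPeriods.KontsevichZagierPeriods.AyoubPiCancellationLine
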